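import Literature.NumberTheory.EllipticCurves.Kato2004.LocalIndexSkeletonProofs
import HarnessLib

/-!
# Kato 2004, Prop. 14.16 (2) / Lemma 14.18 — the LOCAL INDEX `ν` for an ARBITRARY reduction type:
# the lattice count behind `exp*_ω(H¹(ℚ_p, T_pE)) = (c_p·#Ẽ_ns(𝔽_p)/p)·p^{−t}·ℤ_p`, as abstract algebra,
# and the cancellation of `#Ẽ_ns(𝔽_p)/p` against Kato's depleted Euler factor `L_p(E,1)^{−1}`

`Proofs` file (theorems only: no definition, no named fact, debt 0), topic `NumberTheory/EllipticCurves`,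
sequel of `Kato2004/LocalIndexSkeletonProofs.lean` (cell `bsd-rank1-residual`), which proves the count for the
ADDITIVE filtration `E₁ ≤ E₀ ≤ E(ℚ_p) ⊗ ℤ_p` with `[E₀ : E₁] = #Ẽ_ns(𝔽_p) = p`. This file removes that
restriction: ONE submodule `N ≤ M` of `p`-power index `p^s` meeting the torsion trivially with `L(N) = p^r ℤ_p`
gives `L(M) = p^{r − s + t} ℤ_p` (`p^t = #ker L`). Read at a SEMISTABLE prime (the use made of it by the seat
`bsd-2adic-addL2x` GEN 14, cell `bsd-2adic`, in the READING
`Kato2004/SemistableRankZeroShaUpperBoundFineSelmerAtTwoSharp.lean`, step M-T8, at `p = 2`): `M = E(ℚ_p) ⊗ ℤ_p`,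
`N = Ê(p²ℤ_p)` (`log_ω : N ≅ p²ℤ_p`, Silverman IV.6.4 (b) with `r = 2 > v(p)/(p − 1)` — needed at `p = 2`),
`[M : N]` = the `p`-part of `[E : E₀]·[E₀ : E₁]·[E₁ : E₂] = c_p · #Ẽ_ns(𝔽_p) · p` (Kodaira–Néron VII.6.1, VII.2.1,
IV.3.2 (a)), so `s = v_p(c_p) + v_p(#Ẽ_ns(𝔽_p)) + 1`, `r = 2`, whence `log_ω(E(ℚ_p) ⊗ ℤ_p) = p^a ℤ_p` with
`a = r − s + t = t + 1 − v_p(c_p) − v_p(#Ẽ_ns(𝔽_p))` and dually `exp*_ω(H¹(ℚ_p,T)) = p^{−a}ℤ_p` (Bloch–Kato Prop. 3.8).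
The second theorem is the exponent arithmetic by which the reduction type DROPS OUT of Kato's count: with Kato's
value `e = ord_p exp*_ω(z) = 1 + ord_p(L(E,1)/Ω_E) + v_p(L_p(E,1)^{−1})` (Thm. 12.5 (1): the `{p}`-depleted value;
`Ω⁺_γ = Ω_E/2` contributes the `1` at `p = 2`) and Tate's identity `L_p(E,1)^{−1} = #Ẽ_ns(𝔽_p)/p` (Tate 1975 §1;
at `p = 2`: `v₂(L_2(E,1)^{−1}) = v₂(#Ẽ_ns(𝔽₂)) − 1`), the exponent `e + a − t` of Kato's `ν·[…]` equals
`ord_p(L(E,1)/Ω_E) + 1 − v_p(c_p)` WHATEVER `#Ẽ_ns(𝔽_p)` is. Pure `ℤ_p`-module algebra and integer arithmetic;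
nothing about Kato's objects is asserted; the identifications in parentheses are the reading's, not this file's.

References: [Kato2004Asterisque] Prop. 14.16 (2) (p. 244), Lemma 14.18 and its proof (pp. 247–248), Thm. 12.5 (1)
(p. 221); [BlochKato1990] Prop. 3.8, Ex. 3.11; [SilvermanAEC2009] IV.3.2 (a), IV.6.4 (b), VII.2.1, VII.6.1;
[Tate1975] §1 (`∫_{E(ℚ_p)}|ω| = c_p·#Ẽ_ns(𝔽_p)/p`).
-/

noncomputable section

open scoped Classical

namespace Literature.NumberTheory.EllipticCurves.Kato2004.LocalIndex

variable {p : ℕ} [Fact p.Prime]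

/-- **The local lattice count for ONE submodule (any reduction type).** Let `M` be a finitely generated
`ℤ_p`-module, `L : M → ℚ_p` a `ℤ_p`-linear map whose kernel is finite of order `p^t`, and `N ≤ M` a submodule
with `N ∩ ker L = 0`, `[M : N] = p^s` and `L(N) = p^r ℤ_p`. Then `t ≤ s` and `L(M) = p^{r − s + t} ℤ_p`.
(`Kato2004/LocalIndexSkeletonProofs.range_eq_span_zpow_of_filtration` is the case `N = M₁`, `s = 1 + v`, `r = 1`.)
Proof: `[M : N] = [M : N + K]·[N + K : N] = [L(M) : L(N)]·#K`. [cite: Kato2004Asterisque, Lemma 14.18 proof (p. 248), Prop. 14.21 (pp. 248–249)]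
[cite: SilvermanAEC2009, IV.3.2 (a), IV.6.4 (b), VII.2.1, VII.6.1] -/
theorem range_eq_span_zpow_of_submodule {M : Type*} [AddCommGroup M] [Module ℤ_[p] M]
    [Module.Finite ℤ_[p] M] (L : M →ₗ[ℤ_[p]] ℚ_[p]) (N : Submodule ℤ_[p] M)
    {t s : ℕ} {r : ℤ} (hker : Nat.card (LinearMap.ker L) = p ^ t)
    (hdisj : N ⊓ LinearMap.ker L = ⊥)
    (hs : N.toAddSubgroup.index = p ^ s)
    (hLN : N.map L = (Submodule.span ℤ_[p] {((p : ℚ_[p]) ^ (r : ℤ))})) :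
    t ≤ s ∧ LinearMap.range L = (Submodule.span ℤ_[p] {((p : ℚ_[p]) ^ ((r - s + t : ℤ)))}) := by
  set K : Submodule ℤ_[p] M := LinearMap.ker L with hK
  -- `[N + K : N] = #K = p^t`
  have hNK : N.toAddSubgroup.relIndex (N ⊔ K).toAddSubgroup = p ^ t := by
    have hinf : N.toAddSubgroup ⊓ K.toAddSubgroup = ⊥ := by
      have : (N ⊓ K).toAddSubgroup = N.toAddSubgroup ⊓ K.toAddSubgroup := by
        ext x
        simp only [Submodule.mem_toAddSubgroup, AddSubgroup.mem_inf, Submodule.mem_inf]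
      rw [← this, hdisj, Submodule.bot_toAddSubgroup]
    rw [Submodule.sup_toAddSubgroup, AddSubgroup.relIndex_sup_left, ← AddSubgroup.inf_relIndex_right,
      hinf, AddSubgroup.relIndex_bot_left, ← hker]
    rfl
  -- `[M : N + K] = p^{s - t}`
  have hsplit : N.toAddSubgroup.index =
      N.toAddSubgroup.relIndex (N ⊔ K).toAddSubgroup * (N ⊔ K).toAddSubgroup.index :=
    (AddSubgroup.relIndex_mul_index
      (Submodule.toAddSubgroup_mono (le_sup_left : N ≤ N ⊔ K))).symm
  rw [hs, hNK] at hsplit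
  have htle : t ≤ s := by
    have hdvd : p ^ t ∣ p ^ s := Dvd.intro _ hsplit.symm
    exact (Nat.pow_dvd_pow_iff_le_right (Fact.out : p.Prime).one_lt).mp hdvd
  have hidx : (N ⊔ K).toAddSubgroup.index = p ^ (s - t) := by
    have hpt : 0 < p ^ t := pow_pos (Fact.out : p.Prime).pos t
    have : p ^ s = p ^ t * p ^ (s - t) := by
      rw [← pow_add, Nat.add_sub_cancel' htle]
    rw [this] at hsplit
    exact (Nat.eq_of_mul_eq_mul_left hpt hsplit).symm
  -- transport along `L`: `[L(M) : L(N)] = [M : N + K]`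
  have hrel : (Submodule.span ℤ_[p] {((p : ℚ_[p]) ^ (r : ℤ))}).toAddSubgroup.relIndex
      (LinearMap.range L).toAddSubgroup = p ^ (s - t) := by
    rw [← hLN, Submodule.map_toAddSubgroup, ← Submodule.map_top, Submodule.map_toAddSubgroup,
      AddSubgroup.relIndex_map_map, Submodule.top_toAddSubgroup, top_sup_eq,
      AddSubgroup.relIndex_top_right]
    have hk : (L : M →+ ℚ_[p]).ker = K.toAddSubgroup := by
      rw [hK, LinearMap.ker_toAddSubgroup]; rfl
    rw [hk, ← Submodule.sup_toAddSubgroup, hidx]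
  -- `L(M)` is finitely generated and contains `p^r ℤ_p`
  have hfg : (LinearMap.range L).FG := by
    rw [← Submodule.map_top]
    exact Submodule.FG.map _ Module.Finite.fg_top
  have hle : (Submodule.span ℤ_[p] {((p : ℚ_[p]) ^ (r : ℤ))}) ≤ LinearMap.range L := by
    rw [← hLN]; exact LinearMap.map_le_range
  refine ⟨htle, ?_⟩
  have := eq_span_zpow_of_relIndex hfg hle hrel
  rw [this, Nat.cast_sub htle]
  ring_nf

/-- **The same count through a CHAIN `M₂ ≤ M₁ ≤ M₀ ≤ M`** (the semistable reading's filtration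
`Ê(p²) ≤ Ê(p) = E₁ ≤ E₀ ≤ E(ℚ_p) ⊗ ℤ_p`): if `[M : M₀] = p^v` (`v = v_p(c_p)`), `[M₀ : M₁] = p^n`
(`n = v_p(#Ẽ_ns(𝔽_p))`), `[M₁ : M₂] = p`, `M₂ ∩ ker L = 0`, `#ker L = p^t` and `L(M₂) = p² ℤ_p`, then
`L(M) = p^{t + 1 − v − n} ℤ_p` — the exponent `a = t + 1 − v_p(c_p) − v_p(#Ẽ_ns(𝔽_p))` of step M-T8. [cite: Kato2004Asterisque, Lemma 14.18 proof (p. 248)]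
[cite: SilvermanAEC2009, IV.3.2 (a), IV.6.4 (b), VII.2.1, VII.6.1] [cite: Tate1975, §1] -/
theorem range_eq_span_zpow_of_chain {M : Type*} [AddCommGroup M] [Module ℤ_[p] M]
    [Module.Finite ℤ_[p] M] (L : M →ₗ[ℤ_[p]] ℚ_[p]) (M₂ M₁ M₀ : Submodule ℤ_[p] M)
    (h21 : M₂ ≤ M₁) (h10 : M₁ ≤ M₀) {t v n : ℕ}
    (hker : Nat.card (LinearMap.ker L) = p ^ t) (hdisj : M₂ ⊓ LinearMap.ker L = ⊥)
    (hv : M₀.toAddSubgroup.index = p ^ v) (hn : M₁.toAddSubgroup.relIndex M₀.toAddSubgroup = p ^ n)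
    (h2 : M₂.toAddSubgroup.relIndex M₁.toAddSubgroup = p)
    (hL2 : M₂.map L = (Submodule.span ℤ_[p] {((p : ℚ_[p]) ^ ((2 : ℤ)))})) :
    t ≤ v + n + 1 ∧
      LinearMap.range L = (Submodule.span ℤ_[p] {((p : ℚ_[p]) ^ (((t : ℤ) + 1 - v - n : ℤ)))}) := by
  have hs : M₂.toAddSubgroup.index = p ^ (v + n + 1) := by
    rw [← AddSubgroup.relIndex_mul_index (Submodule.toAddSubgroup_mono h21), h2,
      ← AddSubgroup.relIndex_mul_index (Submodule.toAddSubgroup_mono h10), hn, hv]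
    ring
  obtain ⟨htle, hrange⟩ := range_eq_span_zpow_of_submodule L M₂ hker hdisj hs hL2
  refine ⟨htle, ?_⟩
  rw [hrange]
  congr 3
  push_cast
  ring

/-- **The reduction type drops out of Kato's count** (the exponent arithmetic of steps M-T8/M-T9 of the
semistable reading): with `e = 1 + ordL + m₉`, `m₉ = n − 1` (Kato's depleted Euler factor at `2`:
`v₂(L_2(E,1)^{−1}) = v₂(#Ẽ_ns(𝔽₂)) − 1`, Tate's identity `L_p(E,1)^{−1} = #Ẽ_ns(𝔽_p)/p` at `p = 2`) and
`a = t + 1 − v − n` (M-T8), one has `e + a − t = ordL + 1 − v` for every `n`. [cite: Kato2004Asterisque, Thm. 12.5 (1) (p. 221), Prop. 14.16 (2) (p. 244)]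
[cite: Tate1975, §1] -/
theorem count_exponent_reductionFree (ordL t v n e a : ℤ) (he : e = 1 + ordL + (n - 1))
    (ha : a = t + 1 - v - n) : e + a - t = ordL + 1 - v := by
  subst he; subst ha; ring

end Literature.NumberTheory.EllipticCurves.Kato2004.LocalIndex

end
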